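import Mathlib
import HarnessLib
import Literature.MathematicalPhysics.KineticTheory.VelocityFlipNoise
import Literature.MathematicalPhysics.KineticTheory.VelocityFlipGroup
import Literature.MathematicalPhysics.KineticTheory.VelocityFlipEmbeddedChainSteadyState
import Literature.Analysis.Hypoelliptic.CoupledSystem
import Literature.Analysis.Hypoelliptic.EquivTransport
import Summits.AtomisticToContinuum.FouriersLaw.Theorems.VanishingNoiseTransferVanishingNoiseBoundFlipMildDistributional
import Summits.AtomisticToContinuum.FouriersLaw.Theorems.VanishingNoiseTransferVanishingNoiseBoundFlipHypoelliptic
import Summits.AtomisticToContinuum.FouriersLaw.Theorems.OddSectorIrreversibilityCorrectorTheorySmooth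
import Summits.AtomisticToContinuum.FouriersLaw.Theorems.VanishingNoiseTransferNoisyFourierAbelCorrectorExistsAux1

/-!
# Mild Abel correctors are distributional solutions, and these are a.e. smooth (stub `stub_abelCorrectorExists`, part 2)

`--supports stmt-AtomisticToContinuum-11977` helper file (crux `VanishingNoiseTransfer.NoisyFourier`, line
`abel-kapitza-even-corrector`, stub `stub_abelCorrectorExists`, part 2 of 3).

Pinned chain `pinnedChain ω₂ lam β γ` (all parameters `> 0`), `L ≥ 2`, `T > 0`, flip rate `ε`, Abel parameter `s`,
`J = Σ_i j_i` the total current, `S u = Σ_i (u ∘ F_i − u)` the flip noise.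

* `abel_mild_weak` — a measurable `e^{H/(4T)}`-bounded solution of the MILD equation
  `u = R_r (r⁻¹ (J + ε Σ_i u ∘ F_i))`, `r = s + Lε` (`R_r` the resolvent kernel of the flip-free dynamics at
  `(T, T)`, part 1), solves `(L_{T,T} + εS) u = s u − J` in `𝓓'`, in the Lebesgue-transposed form
  `∫ u (−Lφ + 2γT(∂²_{p_0}φ + ∂²_{p_{L−1}}φ) + 2γφ + εSφ) dx = ∫ (s u − J) φ dx` (`φ ∈ C_c^∞`). Proof as for the
  forward fields (`stub_flipMildDistributional`): the transposed resolvent identity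
  `∫ (R_r h)(rφ − ᵀLφ) dx = r ∫ φ h dx` (`pinnedChain_integral_resolvent_mul_transpose`), the bridge
  `revGenerator_eq_neg_generator_add'` and the sitewise Lebesgue symmetry of the flips; the extra `s u φ` comes
  from `r − Lε = s`.
* `abel_weak_smooth` — `C^∞`-HYPOELLIPTICITY WITH THE ZEROTH-ORDER SHIFT `−s`: a measurable, exponentially
  bounded distributional solution of `(L + εS) u = s u − J` agrees a.e. with a smooth function. As in
  `stub_flipHypoelliptic`, the `2^L` flip conjugates `u ∘ ·^w` solve a square Hörmander system
  (`flip_weak_conj`, with the source `F = s u − J`); the term `s u` only changes the constant DIAGONAL coupling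
  coefficient from `εL` to `εL + s`, which `Literature.Analysis.Hypoelliptic.exists_smooth_ae_eq_of_coupledSystem`
  (Kohn's bootstrap for diagonal Hörmander systems with constant zeroth-order coupling) admits.
* `helper_abelCorrectorWeakSmooth` — registered helper (notation-free restatement of `abel_weak_smooth`).

References: Bernardin–Olla 2011 §2.1, §5; Hörmander 1967 Thm 1.1; Kohn 1973; Ethier–Kurtz 1986 Ch. 1 §2.
-/

noncomputable section

open MeasureTheory ProbabilityTheory Filter Topology Set Function
open scoped ContDiff NNReal ENNReal BigOperators
open Literature.MathematicalPhysics.KineticTheory.HeatConduction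
open Literature.MathematicalPhysics.KineticTheory Literature.Probability.Process OscillatorChain
open Literature.Analysis.Distribution Literature.Analysis.Hypoelliptic
open Summit.AtomisticToContinuum.FouriersLaw.Theorems.VanishingNoiseBound
open Summit.AtomisticToContinuum.FouriersLaw.Theorems.OddSectorIrreversibility.Corrector (contDiff_totalBondCurrent)

namespace Summit.AtomisticToContinuum.FouriersLaw.Cruxes.NoisyFourier.AbelKapitzaEvenCorrector

section Weak

variable {ω₂ lam β γ : ℝ} {L : ℕ}

/-- **Mild Abel correctors are distributional solutions of `(L + εS) u = s u − J`.** See the module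
docstring. [cite: BernardinOlla2011, §5] -/
theorem abel_mild_weak (hω : 0 < ω₂) (hl : 0 < lam) (hβ : 0 < β) (hγ : 0 < γ) (hL : 2 ≤ L)
    {T : ℝ} (hT : 0 < T) {ε : ℝ} (hε : 0 < ε) {s : ℝ} (hs : 0 < s) {u : PhaseSpace L → ℝ} (hum : Measurable u)
    (hub : ∃ C : ℝ, ∀ z, |u z| ≤ C * Real.exp (1 / (4 * T) * (pinnedChain ω₂ lam β γ).hamiltonian L z))
    (hmild : ∀ z, u z = ∫ y, (s + (L : ℝ) * ε)⁻¹ *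
        ((∑ i : Fin L, (pinnedChain ω₂ lam β γ).bondCurrent L i y) + ε * ∑ i : Fin L, u (momentumFlip i y))
      ∂((pinnedChainSemigroup hω hl.le hβ.le hγ.le (by omega) hT.le hT.le).resolventKernel
        (s + (L : ℝ) * ε) z)) :
    ∀ φ : PhaseSpace L → ℝ, ContDiff ℝ ∞ φ → HasCompactSupport φ →
      ∫ x, u x * (-((pinnedChain ω₂ lam β γ).generator L T T φ x) +
          2 * γ * (T * partialP (⟨0, by omega⟩ : Fin L) (partialP (⟨0, by omega⟩ : Fin L) φ) x +
            T * partialP (⟨L - 1, by omega⟩ : Fin L) (partialP (⟨L - 1, by omega⟩ : Fin L) φ) x) +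
          2 * γ * φ x + ε * flipNoise L φ x) =
        ∫ x, (s * u x - ∑ i : Fin L, (pinnedChain ω₂ lam β γ).bondCurrent L i x) * φ x := by
  -- adapted from `stub_flipMildDistributional` (…VanishingNoiseBoundFlipMildDistributional)
  intro φ hφ hφc
  obtain ⟨C, hC⟩ := hub
  have hL1 : 1 < L := by omega
  have hL0 : 0 < L := Nat.zero_lt_of_lt hL1
  have hLr : (0 : ℝ) < L := by exact_mod_cast hL0
  set P := pinnedChain ω₂ lam β γ with hPdef
  set θ : ℝ := 1 / (4 * T) with hθdef
  have hθ : 0 < θ := by positivity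
  have h4T : θ < 1 / max T T := by
    rw [max_self, hθdef, one_div_lt_one_div (by positivity) hT]; linarith
  set r : ℝ := s + (L : ℝ) * ε with hrdef
  have hr : 0 < r := by positivity
  have hHc : Continuous (P.hamiltonian L) := pinnedChain_continuous_hamiltonian ω₂ lam β γ L
  have hγ' : P.γ = γ := rfl
  have hφc' : Continuous φ := hφ.continuous
  have hφ2 : ContDiff ℝ 2 φ := hφ.of_le (by norm_cast)
  have hU : ContDiff ℝ ∞ P.U := pinnedChain_contDiff_U ω₂ lam β γ
  have hV : ContDiff ℝ ∞ P.V := pinnedChain_contDiff_V ω₂ lam β γ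
  -- the datum `h = r⁻¹ (J + ε Σ_i u ∘ F_i)` of the mild equation: measurable and `e^{θH}`-bounded
  have hJc : Continuous fun y : PhaseSpace L => ∑ i : Fin L, P.bondCurrent L i y :=
    continuous_finsetSum _ fun i _ => pinnedChain_continuous_bondCurrent ω₂ lam β γ L i
  obtain ⟨CJ, hCJ0, hCJ⟩ := abs_totalCurrent_le_exp (N := L) hω.le hl.le hβ.le γ hθ
  set h : PhaseSpace L → ℝ := fun y => r⁻¹ *
    ((∑ i : Fin L, P.bondCurrent L i y) + ε * ∑ i : Fin L, u (momentumFlip i y)) with hhdef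
  have hgFm : ∀ i : Fin L, Measurable fun y => u (momentumFlip i y) := fun i => hum.comp (measurable_momentumFlip i)
  have hhm : Measurable h := by
    rw [hhdef]
    exact (hJc.measurable.add ((Finset.measurable_sum _ fun i _ => hgFm i).const_mul _)).const_mul _
  have hgFb : ∀ (i : Fin L) (y : PhaseSpace L), |u (momentumFlip i y)| ≤ C * Real.exp (θ * P.hamiltonian L y) := by
    intro i y
    have h1 := hC (momentumFlip i y)
    rwa [P.hamiltonian_momentumFlip] at h1
  set C' : ℝ := r⁻¹ * (CJ + ε * (L * C)) with hC'def
  have hhb : ∀ y, |h y| ≤ C' * Real.exp (θ * P.hamiltonian L y) := by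
    intro y
    have hsum : |∑ i : Fin L, u (momentumFlip i y)| ≤ L * (C * Real.exp (θ * P.hamiltonian L y)) := by
      calc |∑ i : Fin L, u (momentumFlip i y)| ≤ ∑ i : Fin L, |u (momentumFlip i y)| :=
            Finset.abs_sum_le_sum_abs _ _
        _ ≤ ∑ _i : Fin L, C * Real.exp (θ * P.hamiltonian L y) := Finset.sum_le_sum fun i _ => hgFb i y
        _ = L * (C * Real.exp (θ * P.hamiltonian L y)) := by
            rw [Finset.sum_const, Finset.card_univ, Fintype.card_fin, nsmul_eq_mul]
    calc |h y| = r⁻¹ * |(∑ i : Fin L, P.bondCurrent L i y) + ε * ∑ i : Fin L, u (momentumFlip i y)| := by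
          rw [hhdef]; dsimp only; rw [abs_mul, abs_of_pos (inv_pos.2 hr)]
      _ ≤ r⁻¹ * (|∑ i : Fin L, P.bondCurrent L i y| + ε * |∑ i : Fin L, u (momentumFlip i y)|) := by
          refine mul_le_mul_of_nonneg_left ((abs_add_le _ _).trans ?_) (inv_pos.2 hr).le
          rw [abs_mul, abs_of_pos hε]
      _ ≤ r⁻¹ * (CJ * Real.exp (θ * P.hamiltonian L y) + ε * (L * (C * Real.exp (θ * P.hamiltonian L y)))) := by
          gcongr
          exact hCJ y
      _ = C' * Real.exp (θ * P.hamiltonian L y) := by rw [hC'def]; ring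
  -- (1) the transposed resolvent identity `∫ (R_r h)(rφ − ᵀLφ) dx = r ∫ φ h dx`, with `R_r h = u`
  have hA := pinnedChain_integral_resolvent_mul_transpose hω hl hβ hγ hL1 hT hT hr hθ h4T hφ hφc hhm hhb
  have hRh : ∀ x, ∫ y, h y ∂((pinnedChainSemigroup hω hl.le hβ.le hγ.le (Nat.zero_lt_of_lt hL1) hT.le
      hT.le).resolventKernel r x) = u x := fun x => (hmild x).symm
  set W : PhaseSpace L → ℝ := fun x => r * φ x - (sdeGenerator (fun y => -P.drift L y) (P.bathVecL L T)
    (P.bathVecR L T) φ x + 2 * γ * φ x) with hWdef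
  have hgW : ∫ x, u x * W x = r * ∫ x, φ x * h x := by
    rw [← hA]
    refine integral_congr_ae (ae_of_all _ fun x => ?_)
    dsimp only
    rw [hRh x]
  -- (2) continuity / support / integrability bookkeeping
  have hWc : Continuous W := by
    rw [hWdef]
    exact (continuous_const.mul hφc').sub
      ((continuous_sdeGenerator _ _ (P.contDiff_drift hU hV L).continuous.neg hφ2).add
        (continuous_const.mul hφc'))
  have hWs : HasCompactSupport W := by
    rw [hWdef]
    exact hφc.mul_left.sub ((hasCompactSupport_sdeGenerator _ _ hφc).add hφc.mul_left)
  have hφFc : ∀ i : Fin L, Continuous fun x => φ (momentumFlip i x) := fun i =>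
    hφc'.comp (continuous_momentumFlip i)
  have hφFs : ∀ i : Fin L, HasCompactSupport fun x => φ (momentumFlip i x) := by
    intro i
    let e : PhaseSpace L ≃ₜ PhaseSpace L :=
      { toFun := momentumFlip i, invFun := momentumFlip i, left_inv := momentumFlip_momentumFlip i,
        right_inv := momentumFlip_momentumFlip i, continuous_toFun := continuous_momentumFlip i,
        continuous_invFun := continuous_momentumFlip i }
    exact hφc.comp_homeomorph e
  have hEc : Continuous fun x => C * Real.exp (θ * P.hamiltonian L x) := by fun_prop
  have hub' : ∀ x, |u x| ≤ C * Real.exp (θ * P.hamiltonian L x) := hC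
  have iW : Integrable fun x => u x * W x := integrable_mul_of_hasCompactSupport_of_abs_le' hWc hWs hum hEc hub'
  have iuφ : Integrable fun x => u x * φ x := integrable_mul_of_hasCompactSupport_of_abs_le' hφc' hφc hum hEc hub'
  have igF : ∀ i : Fin L, Integrable fun x => u x * φ (momentumFlip i x) := fun i =>
    integrable_mul_of_hasCompactSupport_of_abs_le' (hφFc i) (hφFs i) hum hEc hub'
  have iFg : ∀ i : Fin L, Integrable fun x => u (momentumFlip i x) * φ x := fun i =>
    integrable_mul_of_hasCompactSupport_of_abs_le' hφc' hφc (hgFm i) hEc (hgFb i)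
  have iφJ : Integrable fun x => φ x * ∑ i : Fin L, P.bondCurrent L i x :=
    (hφc'.mul hJc).integrable_of_hasCompactSupport hφc.mul_right
  -- (3) the flip symmetry, sitewise: `∫ u · (φ ∘ F_i) dx = ∫ (u ∘ F_i) · φ dx`
  have hflip : ∀ i : Fin L, ∫ x, u x * φ (momentumFlip i x) = ∫ x, u (momentumFlip i x) * φ x := fun i =>
    integral_mul_comp_momentumFlip (measurePreserving_momentumFlip_volume i) φ u
  set Y : ℝ := ∑ i : Fin L, ∫ x, u (momentumFlip i x) * φ x with hYdef
  set X : ℝ := ∫ x, φ x * ∑ i : Fin L, P.bondCurrent L i x with hXdef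
  -- (4) `∫ φ h dx = r⁻¹ (X + ε Y)`
  have hφh : ∫ x, φ x * h x = r⁻¹ * (X + ε * Y) := by
    have e1 : ∀ x, φ x * h x =
        r⁻¹ * (φ x * ∑ i : Fin L, P.bondCurrent L i x) + r⁻¹ * ε * ∑ i : Fin L, u (momentumFlip i x) * φ x := by
      intro x
      rw [← Finset.sum_mul]
      simp only [hhdef]
      ring
    rw [integral_congr_ae (ae_of_all _ e1), integral_add (iφJ.const_mul _)
      ((integrable_finsetSum _ fun i _ => iFg i).const_mul _), integral_const_mul, integral_const_mul,
      integral_finsetSum _ fun i _ => iFg i]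
    ring
  -- (5) the pointwise form of the weak-form integrand: `u ᵀL_εφ = −u W + s u φ + ε Σ_i u (φ ∘ F_i)`
  have hpt : ∀ x, u x * (-(P.generator L T T φ x) +
      2 * γ * (T * partialP (⟨0, hL0⟩ : Fin L) (partialP (⟨0, hL0⟩ : Fin L) φ) x +
        T * partialP (⟨L - 1, Nat.sub_lt hL0 one_pos⟩ : Fin L)
          (partialP (⟨L - 1, Nat.sub_lt hL0 one_pos⟩ : Fin L) φ) x) +
      2 * γ * φ x + ε * flipNoise L φ x) =
      -(u x * W x) + s * (u x * φ x) + ε * ∑ i : Fin L, u x * φ (momentumFlip i x) := by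
    intro x
    have hb := revGenerator_eq_neg_generator_add' P hL0 (T_L := T) (T_R := T)
      (by rw [hγ']; positivity) (by rw [hγ']; positivity) hφ2 x
    rw [hγ'] at hb
    have hS : flipNoise L φ x = (∑ i : Fin L, φ (momentumFlip i x)) - L * φ x := by
      rw [flipNoise_eq, Finset.sum_sub_distrib, Finset.sum_const, Finset.card_univ, Fintype.card_fin,
        nsmul_eq_mul]
    rw [hS, ← Finset.mul_sum, hWdef, hrdef]
    linear_combination (-(u x)) * hb
  -- (6) assemble
  have hr1 : r * r⁻¹ = 1 := mul_inv_cancel₀ hr.ne'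
  have hfin : ∀ x : PhaseSpace L, (s * u x - ∑ i : Fin L, P.bondCurrent L i x) * φ x =
      s * (u x * φ x) - φ x * ∑ i : Fin L, P.bondCurrent L i x := fun x => by ring
  calc ∫ x, u x * (-(P.generator L T T φ x) +
        2 * γ * (T * partialP (⟨0, hL0⟩ : Fin L) (partialP (⟨0, hL0⟩ : Fin L) φ) x +
          T * partialP (⟨L - 1, Nat.sub_lt hL0 one_pos⟩ : Fin L)
            (partialP (⟨L - 1, Nat.sub_lt hL0 one_pos⟩ : Fin L) φ) x) +
        2 * γ * φ x + ε * flipNoise L φ x)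
      = ∫ x, (-(u x * W x) + s * (u x * φ x) + ε * ∑ i : Fin L, u x * φ (momentumFlip i x)) :=
        integral_congr_ae (ae_of_all _ hpt)
    _ = -(∫ x, u x * W x) + s * (∫ x, u x * φ x) + ε * ∑ i : Fin L, ∫ x, u x * φ (momentumFlip i x) := by
        have i1 : Integrable fun x => -(u x * W x) + s * (u x * φ x) := iW.fun_neg.add (iuφ.const_mul s)
        have i2 : Integrable fun x => ε * ∑ i : Fin L, u x * φ (momentumFlip i x) :=
          (integrable_finsetSum _ fun i _ => igF i).const_mul ε
        rw [integral_add i1 i2, integral_add iW.fun_neg (iuφ.const_mul s), integral_neg, integral_const_mul,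
          integral_const_mul, integral_finsetSum _ fun i _ => igF i]
    _ = -(r * (r⁻¹ * (X + ε * Y))) + s * (∫ x, u x * φ x) + ε * Y := by
        rw [hgW, hφh, hYdef]
        simp only [hflip]
    _ = -X + s * ∫ x, u x * φ x := by
        rw [← mul_assoc, hr1, one_mul]; ring
    _ = ∫ x, (s * u x - ∑ i : Fin L, P.bondCurrent L i x) * φ x := by
        rw [integral_congr_ae (ae_of_all _ hfin), integral_sub (iuφ.const_mul s) iφJ, integral_const_mul, hXdef]
        ring

end Weak

/-! ## Hypoellipticity with the zeroth-order shift `−s` -/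

section Hypo

variable {ω₂ lam β γ : ℝ} {L : ℕ}

/-- **Exponentially bounded distributional solutions of `(L_{T_L,T_R} + εS) u = s u − J` are a.e. smooth.**
See the module docstring: the flip conjugates `u ∘ ·^w` solve the square Hörmander system of
`stub_flipHypoelliptic` with smooth sources `−J ∘ ·^w` and the constant coupling matrix
`(εL + s)[w' = w] − ε Σ_i [w' = w ∆ {i}]`, which `exists_smooth_ae_eq_of_coupledSystem` admits.
[cite: BernardinOlla2011, §5] -/
theorem abel_weak_smooth (hβ : 0 < β) (hγ : 0 < γ) (hL : 2 ≤ L)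
    {T_L T_R : ℝ} (hTL : 0 < T_L) (hTR : 0 < T_R) (ε s : ℝ) {u : PhaseSpace L → ℝ} (hum : Measurable u)
    (hub : ∃ C θ : ℝ, ∀ x, |u x| ≤ C * Real.exp (θ * (pinnedChain ω₂ lam β γ).hamiltonian L x))
    (hweak : ∀ φ : PhaseSpace L → ℝ, ContDiff ℝ ∞ φ → HasCompactSupport φ →
      ∫ x, u x * (-((pinnedChain ω₂ lam β γ).generator L T_L T_R φ x) +
          2 * γ * (T_L * partialP (⟨0, by omega⟩ : Fin L) (partialP (⟨0, by omega⟩ : Fin L) φ) x +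
            T_R * partialP (⟨L - 1, by omega⟩ : Fin L) (partialP (⟨L - 1, by omega⟩ : Fin L) φ) x) +
          2 * γ * φ x + ε * flipNoise L φ x) =
        ∫ x, (s * u x - ∑ i : Fin L, (pinnedChain ω₂ lam β γ).bondCurrent L i x) * φ x) :
    ∃ v : PhaseSpace L → ℝ, ContDiff ℝ ∞ v ∧ ∀ᵐ x ∂(volume : Measure (PhaseSpace L)), u x = v x := by
  -- adapted from `stub_flipHypoelliptic` (…VanishingNoiseBoundFlipHypoelliptic): only the coupling changes
  set P := pinnedChain ω₂ lam β γ with hP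
  have hL0 : 0 < L := Nat.zero_lt_of_lt hL
  have hU : ContDiff ℝ ∞ P.U := pinnedChain_contDiff_U ω₂ lam β γ
  have hV : ContDiff ℝ ∞ P.V := pinnedChain_contDiff_V ω₂ lam β γ
  have hγ' : P.γ = γ := rfl
  have hγTL : 0 < P.γ * T_L := by rw [hγ']; positivity
  have hV2 : ∀ r, deriv (deriv P.V) r ≠ 0 := fun r => by
    rw [hP, pinnedChain_deriv_deriv_V]; positivity
  have hY : ContDiff ℝ ∞ (P.drift L) := P.contDiff_drift hU hV L
  have hX : ∀ b, ContDiff ℝ ∞ (P.bathField hL0 T_L T_R b) := fun _ => contDiff_const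
  -- the multi-site flips and their linear equivalences
  set Φ : Finset (Fin L) → PhaseSpace L → PhaseSpace L :=
    fun w x => (x.1, fun j => if j ∈ w then -x.2 j else x.2 j) with hΦdef
  have hΦ : ∀ w x, Φ w x = (x.1, fun j => if j ∈ w then -x.2 j else x.2 j) := fun w x => rfl
  have hex : ∀ w : Finset (Fin L), ∃ Fw : PhaseSpace L ≃L[ℝ] PhaseSpace L, ∀ x, Fw x = Φ w x := fun w =>
    (exists_multiFlip_equiv Φ hΦ w).imp fun _ h => h.1
  choose Fw hFw using hex
  -- the conjugated operators `P_w` and their bracket condition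
  set X₀W : Finset (Fin L) → PhaseSpace L → PhaseSpace L := fun w y => Fw w (P.drift L ((Fw w).symm y))
    with hX₀W
  set XW : Finset (Fin L) → Fin 2 → PhaseSpace L → PhaseSpace L :=
    fun w b y => Fw w (P.bathField hL0 T_L T_R b ((Fw w).symm y)) with hXW
  have hX₀Ws : ∀ w, ContDiff ℝ ∞ (X₀W w) := fun w => contDiff_conj_equiv (Fw w) hY
  have hXWs : ∀ w b, ContDiff ℝ ∞ (XW w b) := fun w b => contDiff_conj_equiv (Fw w) (hX b)
  have hgen : ∀ w, IsBracketGenerating (fun o : Option (Fin 2) => o.elim (X₀W w) (XW w)) univ := fun w =>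
    isBracketGenerating_conj_equiv_elim hY hX (Fw w) (isBracketGenerating_driftFamily P hU hV hL0 hγTL hV2)
  -- the coupled system solved by the conjugates `u ∘ ·^w`
  haveI := isAddHaarMeasure_volume_phaseSpace L
  have hloc : ∀ w, LocallyIntegrable (fun x => u (Φ w x)) volume := fun w =>
    locallyIntegrable_comp_of_exp_bound hum hub (continuous_multiFlip Φ hΦ w)
  have hJs : ContDiff ℝ ∞ fun x : PhaseSpace L => ∑ i : Fin L, P.bondCurrent L i x :=
    contDiff_totalBondCurrent ω₂ lam β γ L
  have hfs : ∀ w, ContDiff ℝ ∞ (fun x => -∑ i : Fin L, P.bondCurrent L i (Φ w x)) := fun w => by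
    have e : (fun x => -∑ i : Fin L, P.bondCurrent L i (Φ w x)) =
        fun x => -((fun y => ∑ i : Fin L, P.bondCurrent L i y) (Fw w x)) := by simp only [hFw]
    rw [e]
    exact (hJs.comp (Fw w).contDiff).neg
  have hsys : ∀ (w : Finset (Fin L)) (φ : PhaseSpace L → ℝ), ContDiff ℝ ∞ φ → HasCompactSupport φ →
      ∫ x, u (Φ w x) * hormanderTranspose (X₀W w) (XW w) (fun _ => 0) φ x =
        (∫ x, (-∑ i : Fin L, P.bondCurrent L i (Φ w x)) * φ x) + ∑ w', ((ε * L + s) * (if w' = w then 1 else 0) -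
          ε * ∑ i : Fin L, (if w' = symmDiff w {i} then 1 else 0)) * ∫ x, u (Φ w' x) * φ x := by
    intro w φ hφ hφc
    rw [flip_coupling_sum ε (ε * L + s) w fun w' => ∫ x, u (Φ w' x) * φ x]
    have h1 := flip_weak_conj hL hTL hTR hγ Φ hΦ hum hub hweak w (Fw w) (hFw w) hφ hφc
    have iu : Integrable (fun x => u (Φ w x) * φ x) := by
      have := (hloc w).integrable_smul_right_of_hasCompactSupport hφ.continuous hφc
      simpa only [smul_eq_mul] using this
    have iJ : Integrable (fun x => (∑ i : Fin L, P.bondCurrent L i (Φ w x)) * φ x) :=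
      ((hJs.continuous.comp (continuous_multiFlip Φ hΦ w)).mul hφ.continuous).integrable_of_hasCompactSupport
        hφc.mul_left
    have h2 : ∫ x, (s * u (Φ w x) - ∑ i : Fin L, P.bondCurrent L i (Φ w x)) * φ x =
        s * (∫ x, u (Φ w x) * φ x) - ∫ x, (∑ i : Fin L, P.bondCurrent L i (Φ w x)) * φ x := by
      have e : ∀ x, (s * u (Φ w x) - ∑ i : Fin L, P.bondCurrent L i (Φ w x)) * φ x =
          s * (u (Φ w x) * φ x) - (∑ i : Fin L, P.bondCurrent L i (Φ w x)) * φ x := fun x => by ring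
      simp_rw [e]
      rw [integral_sub (iu.const_mul s) iJ, integral_const_mul]
    have h3 : ∫ x, (-∑ i : Fin L, P.bondCurrent L i (Φ w x)) * φ x =
        -∫ x, (∑ i : Fin L, P.bondCurrent L i (Φ w x)) * φ x := by
      rw [← integral_neg]
      exact integral_congr_ae (ae_of_all _ fun x => by ring)
    rw [h1, h2, h3]
    ring
  obtain ⟨g, hg, hug⟩ := exists_smooth_ae_eq_of_coupledSystem (volume : Measure (PhaseSpace L)) hX₀Ws hXWs
    (fun _ => contDiff_const) hgen
    (fun w w' => (ε * L + s) * (if w' = w then 1 else 0) - ε * ∑ i : Fin L, (if w' = symmDiff w {i} then 1 else 0))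
    hloc hfs hsys ∅
  refine ⟨g, hg, ?_⟩
  have e : (fun x => u (Φ ∅ x)) = u := funext fun x => by rw [multiFlip_empty Φ hΦ]
  rw [e] at hug
  exact hug

end Hypo

/-! ## Registered helper -/

/-- Registered helper sub-goal `helper_abelCorrectorWeakSmooth` of stub `stub_abelCorrectorExists` (line
`abel-kapitza-even-corrector`, crux stmt-AtomisticToContinuum-11977): `C^∞`-hypoellipticity of `L + εS − s`
— exponentially bounded distributional solutions of `(L_{T_L,T_R} + εS) u = s u − J` are a.e. smooth
(`abel_weak_smooth`). [cite: BernardinOlla2011, §5] -/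
theorem helper_abelCorrectorWeakSmooth : ∀ (ω₂ lam β γ : ℝ), 0 < ω₂ → 0 < lam → 0 < β → 0 < γ → ∀ (L : ℕ) (hL : 2 ≤ L) (T_L T_R ε s : ℝ), 0 < T_L → 0 < T_R → ∀ (u : Literature.MathematicalPhysics.KineticTheory.HeatConduction.PhaseSpace L → ℝ), Measurable u → (∃ C θ : ℝ, ∀ x, |u x| ≤ C * Real.exp (θ * (Literature.MathematicalPhysics.KineticTheory.HeatConduction.pinnedChain ω₂ lam β γ).hamiltonian L x)) → (∀ φ : Literature.MathematicalPhysics.KineticTheory.HeatConduction.PhaseSpace L → ℝ, ContDiff ℝ ((⊤ : ℕ∞) : WithTop ℕ∞) φ → HasCompactSupport φ → MeasureTheory.integral MeasureTheory.volume (fun x => u x * (-((Literature.MathematicalPhysics.KineticTheory.HeatConduction.pinnedChain ω₂ lam β γ).generator L T_L T_R φ x) + 2 * γ * (T_L * Literature.MathematicalPhysics.KineticTheory.HeatConduction.partialP (⟨0, by omega⟩ : Fin L) (Literature.MathematicalPhysics.KineticTheory.HeatConduction.partialP (⟨0, by omega⟩ : Fin L) φ) x + T_R * Literature.MathematicalPhysics.KineticTheory.HeatConduction.partialP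 (⟨L - 1, by omega⟩ : Fin L) (Literature.MathematicalPhysics.KineticTheory.HeatConduction.partialP (⟨L - 1, by omega⟩ : Fin L) φ) x) + 2 * γ * φ x + ε * Literature.MathematicalPhysics.KineticTheory.HeatConduction.flipNoise L φ x)) = MeasureTheory.integral MeasureTheory.volume (fun x => (s * u x - ∑ i : Fin L, (Literature.MathematicalPhysics.KineticTheory.HeatConduction.pinnedChain ω₂ lam β γ).bondCurrent L i x) * φ x)) → ∃ v : Literature.MathematicalPhysics.KineticTheory.HeatConduction.PhaseSpace L → ℝ, ContDiff ℝ ((⊤ : ℕ∞) : WithTop ℕ∞) v ∧ Filter.Eventually (fun x => u x = v x) (MeasureTheory.ae (MeasureTheory.volume : MeasureTheory.Measure (Literature.MathematicalPhysics.KineticTheory.HeatConduction.PhaseSpace L))) :=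
  fun _ _ _ _ _ _ hβ hγ _ hL _ _ ε s hTL hTR _ hum hub hweak => abel_weak_smooth hβ hγ hL hTL hTR ε s hum hub hweak

end Summit.AtomisticToContinuum.FouriersLaw.Cruxes.NoisyFourier.AbelKapitzaEvenCorrector

end
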